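import Summits.QuantumFields.YangMills.Theorems.VirialFluxGapLeftChartLinearisation
import HarnessLib

/-!
# ★★ Every gauge field linearises near the stabiliser: the SLICE-FREE transversality input
# (layer (B2/B3) of the DIRECT Laplace road to ⟨stmt-QuantumFields-24204⟩ `VirialFluxGap.SharpTwistedLaplace`)

Helper module (free-hands work of width seat ym-line-sfw-p2-w3 g56, cell ym-idea-1; `--supports 24204`).

THE STATEMENT (`exists_skew_linearised_gauge_le`).  `L ≥ 2`, `z ≠ 0`, `R` a zero of the twisted ring deficit `F_z` (✓`RingDeficit.ringDeficit`)
with time-constant slices, `P` the ring with LEFT-chart coordinates `a = (A_{i,e}, B_x)` at `R` (`↑P_{i,e} = e^{A_{i,e}}↑R_e`, `↑P.2_x = e^{B_x}↑R.2_x`,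
Frobenius norms `≤ m ≤ ¼`), `h` ANY gauge field, `D = ringDist(h·P, R)` the chordal ring distance of the Theses (inlined).  Then there is
`ξ : sites → 𝔰𝔲(2)` (skew-Hermitian, traceless) with

  `‖a + G_R ξ‖_{ℓ²} ≤ √(2D) + 2500·L⁴·(m² + D)`,   `G_R ξ = (ξ_x − R_e ξ_y R_e⁻¹ ; ξ_x − g_x ξ_x g_x⁻¹)` the linearised gauge modes.

PROOF.  ✓`exists_centreElem_fd_le_of_ringDeficit_eq_zero` (stabiliser rigidity at the zero `R`, fed with `δ = (3/2)m + √(2D)` from the triangle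
inequality through `h·P`) puts `h` within `ε = 9Lδ` of a sign `±1`; the sign is invisible to the action, so `H = ±h` is `ε`-close to `1` sitewise;
`ξ` = skew part of `H − 1`; per variable ✓`norm_linearised_link_le`; the `ℓ²` assembly ✓`sqrt_sum_sq_le_of_le_add_const` over the `6L⁴ + L³`
variables and the remainder arithmetic ✓`remainder_bound_aux`.

WHY (consumption).  On any linear slice `V ∋ a` through `R` at angle `θ` to the gauge modes, `‖a + G_R ξ‖ ≥ sin θ·‖a‖` for every `ξ`, so
`inf_h ringDist(h·e^{a}R, R) ≳ sin²θ·‖a‖²` once `‖a‖ ≲ sin θ∕L⁴` — with ✓⟨24320⟩ `QuadraticGrowth` this is the `κ‖y‖² ≤ F_z(σ y)` of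
✓`coercive_of_quadratic_growth`, i.e. the `hcoer`/`λ` of ✓`laplaceMethod_quantitative_orbit`, with NO lattice Poincaré inequality.

Everything here is PROVED; no definitions, no named facts (namespace `Summit.QuantumFields.YangMills.Theorems.VirialFluxGap.ChartPhase`).
HONEST FRAMING: lattice gauge bookkeeping; ⟨24204⟩, ⟨24319⟩ and every rung stay OPEN; the Yang–Mills mass gap (Clay) is NOT touched; no summit
is proved by a line.

## References
* M. Lüscher, Nucl. Phys. B219 (1983), §2. [Luscher1983]
* A. González-Arroyo, C. P. Korthals Altes, Nucl. Phys. B311 (1988), §2. [GonzalezarroyoAltes1988]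
-/

set_option autoImplicit false

noncomputable section

open scoped Matrix Matrix.Norms.Frobenius BigOperators
open NormedSpace
open Literature.MathematicalPhysics.QuantumFieldTheory hiding SU2
open Literature.MathematicalPhysics.QuantumLattice
open Summit.QuantumFields.YangMills.Theorems.FemtoTransferGap
open Summit.QuantumFields.YangMills.Theorems.FemtoTransferGap.TT
open Summit.QuantumFields.YangMills.Theorems.FemtoTransferGap.TwoLattice
open Summit.QuantumFields.YangMills.Theorems.FemtoTransferGap.TwoLattice.Flat
open Summit.QuantumFields.YangMills.Theorems.FemtoTransferGap.TwoLattice.Cov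
open Summit.QuantumFields.YangMills.Theorems.ToronValleyVolume.Lojasiewicz
open Summit.QuantumFields.YangMills.Theorems.TwistEaterVolume.Quadratic
open Summit.QuantumFields.YangMills.Theorems.VirialFluxGap.RingDeficit
open Summit.QuantumFields.YangMills.Theorems.ColdBoxAllGroups (norm_exp_sub_one_sub_le norm_exp_sub_one_le')

namespace Summit.QuantumFields.YangMills.Theorems.VirialFluxGap.ChartPhase

variable {L : ℕ} [NeZero L]

/-- ★★ **Theorem A — every gauge field linearises near the stabiliser.**  `L ≥ 2`, `z ≠ 0`, `R` a zero of the twisted ring deficit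
(`F_z(R) = 0`, slices constant in time), `P` the ring with LEFT-chart coordinates `a = (A_{i,e}, B_x)` at `R` (`↑P_{i,e} = e^{A_{i,e}}↑R_e`,
`↑P.2_x = e^{B_x}↑R.2_x`, Frobenius norms `≤ m ≤ ¼`), and `h` ANY gauge field.  Then there is a field `ξ : sites → 𝔰𝔲(2)` (skew-Hermitian,
traceless — the skew part of `±h − 1`, the sign from ✓`exists_centreElem_fd_le_of_ringDeficit_eq_zero`) such that the chart coordinate
corrected by the LINEARISED GAUGE MODE `G_R ξ = (ξ_x − R_e ξ_y R_e⁻¹ ; ξ_x − g_x ξ_x g_x⁻¹)` is controlled by the chordal distance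
`D = ringDist(h·P, R)` (inlined as in the Theses):

  `‖a + G_R ξ‖_{ℓ²} ≤ √(2D) + 2500·L⁴·(m² + D)`.

Consequence (slice-free transversality ∕ coercivity input of the direct Laplace road to ⟨24204⟩): on any linear slice `V` through `R`
making an angle `θ` with the gauge modes, `dist(a, gauge modes) ≥ sin θ·‖a‖`, so `ringDist(h·P, R) ≳ sin²θ‖a‖²` uniformly in `h` once
`‖a‖ ≪ sin θ∕L⁴`. [cite: Luscher1983, §2] [cite: GonzalezarroyoAltes1988, §2] -/
theorem exists_skew_linearised_gauge_le (hL : 2 ≤ L) {z : Fin 3 → Bool} (hz : z ≠ fun _ => false)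
    {R : (Fin (2 * L - 1 + 1) → GaugeConfig 3 L SU2) × (Site 3 L → SU2)} (hR0 : ringDeficit L z R = 0)
    (hRc : ∀ i, R.1 i = R.1 0) {m : ℝ} (hm : m ≤ 1 / 4)
    {A : Fin (2 * L - 1 + 1) → Edge 3 L → Matrix (Fin 2) (Fin 2) ℂ} {B : Site 3 L → Matrix (Fin 2) (Fin 2) ℂ}
    (hA : ∀ i e, ‖A i e‖ ≤ m) (hB : ∀ x, ‖B x‖ ≤ m)
    {P : (Fin (2 * L - 1 + 1) → GaugeConfig 3 L SU2) × (Site 3 L → SU2)}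
    (hP1 : ∀ i e, (P.1 i e : Matrix (Fin 2) (Fin 2) ℂ) = exp (A i e) * (R.1 0 e : Matrix (Fin 2) (Fin 2) ℂ))
    (hP2 : ∀ x, (P.2 x : Matrix (Fin 2) (Fin 2) ℂ) = exp (B x) * (R.2 x : Matrix (Fin 2) (Fin 2) ℂ))
    (h : Site 3 L → SU2) :
    ∃ ξ : Site 3 L → Matrix (Fin 2) (Fin 2) ℂ, (∀ x, (ξ x)ᴴ = -ξ x) ∧ (∀ x, (ξ x).trace = 0) ∧
      Real.sqrt ((∑ i : Fin (2 * L - 1 + 1), ∑ e : Edge 3 L,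
            ‖A i e + (ξ e.1 - (R.1 0 e : Matrix (Fin 2) (Fin 2) ℂ) * ξ (e.1.shift e.2) * (R.1 0 e : Matrix (Fin 2) (Fin 2) ℂ)ᴴ)‖ ^ 2) +
          ∑ x : Site 3 L, ‖B x + (ξ x - (R.2 x : Matrix (Fin 2) (Fin 2) ℂ) * ξ x * (R.2 x : Matrix (Fin 2) (Fin 2) ℂ)ᴴ)‖ ^ 2) ≤
        Real.sqrt (2 * ((∑ i, (6 * (L : ℝ) ^ 3 - timeCoupling su2Rep (gaugeTransform h (P.1 i)) (R.1 i))) +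
            ∑ x, (2 - ((su2Rep ((h * P.2 * h⁻¹) x * (R.2 x)⁻¹)).trace).re))) +
          2500 * (L : ℝ) ^ 4 * (m ^ 2 + ((∑ i, (6 * (L : ℝ) ^ 3 - timeCoupling su2Rep (gaugeTransform h (P.1 i)) (R.1 i))) +
            ∑ x, (2 - ((su2Rep ((h * P.2 * h⁻¹) x * (R.2 x)⁻¹)).trace).re))) := by
  have hm0 : 0 ≤ m := (norm_nonneg _).trans (hB 0)
  have hL1 : (1 : ℝ) ≤ (L : ℝ) := by exact_mod_cast NeZero.one_le
  set D : ℝ := (∑ i, (6 * (L : ℝ) ^ 3 - timeCoupling su2Rep (gaugeTransform h (P.1 i)) (R.1 i))) +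
      ∑ x, (2 - ((su2Rep ((h * P.2 * h⁻¹) x * (R.2 x)⁻¹)).trace).re) with hD
  -- `D` is half a sum of squared Frobenius distances
  set f1 : Fin (2 * L - 1 + 1) → Edge 3 L → ℝ := fun i e => fd (gaugeTransform h (P.1 i) e) (R.1 i e) with hf1
  set f2 : Site 3 L → ℝ := fun x => fd ((h * P.2 * h⁻¹) x) (R.2 x) with hf2
  have hD_eq : 2 * D = (∑ i, ∑ e, f1 i e ^ 2) + ∑ x, f2 x ^ 2 := by
    rw [hD, mul_add, Finset.mul_sum, Finset.mul_sum]
    congr 1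
    · refine Finset.sum_congr rfl fun i _ => ?_
      rw [timeCoupling_deficit_eq_half_sum_fd_sq, Finset.mul_sum]
      refine Finset.sum_congr rfl fun e _ => ?_
      rw [hf1]; ring
    · refine Finset.sum_congr rfl fun x _ => ?_
      rw [two_sub_re_trace_eq_half_fd_sq, hf2]; ring
  have hS0 : 0 ≤ (∑ i, ∑ e, f1 i e ^ 2) + ∑ x, f2 x ^ 2 := by positivity
  have hD0 : 0 ≤ D := by linarith
  have hs0 : 0 ≤ Real.sqrt (2 * D) := Real.sqrt_nonneg _
  have hs2 : Real.sqrt (2 * D) ^ 2 = 2 * D := Real.sq_sqrt (by positivity)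
  -- single terms are `≤ √(2D)`
  have hlink_le : ∀ i e, fd (gaugeTransform h (P.1 i) e) (R.1 i e) ≤ Real.sqrt (2 * D) := by
    intro i e
    apply Real.le_sqrt_of_sq_le
    have h1 := sq_le_double_sum_sq f1 i e
    have h2 : 0 ≤ ∑ x, f2 x ^ 2 := by positivity
    have h3 : f1 i e = fd (gaugeTransform h (P.1 i) e) (R.1 i e) := by rw [hf1]
    rw [← h3, hD_eq]; linarith
  have hseam_le : ∀ x, fd ((h * P.2 * h⁻¹) x) (R.2 x) ≤ Real.sqrt (2 * D) := by
    intro x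
    apply Real.le_sqrt_of_sq_le
    have h1 := sq_le_sum_sq f2 x
    have h2 : 0 ≤ ∑ i, ∑ e, f1 i e ^ 2 := by positivity
    have h3 : f2 x = fd ((h * P.2 * h⁻¹) x) (R.2 x) := by rw [hf2]
    rw [← h3, hD_eq]; linarith
  -- the chart moves each variable by `≤ (3/2)m`
  have hRP1 : ∀ i e, fd (R.1 i e) (P.1 i e) ≤ 3 / 2 * m := fun i e => by
    rw [hRc i]; exact fd_le_of_coe_eq_exp_mul hm (hA i e) (hP1 i e)
  have hRP2 : ∀ x, fd (R.2 x) (P.2 x) ≤ 3 / 2 * m := fun x => fd_le_of_coe_eq_exp_mul hm (hB x) (hP2 x)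
  -- stabiliser rigidity: `h` is within `ε = 9L·δ` of a sign
  set δ : ℝ := 3 / 2 * m + Real.sqrt (2 * D) with hδ
  have hδ0 : 0 ≤ δ := by positivity
  have hlinkδ : ∀ e, fd (gaugeTransform h (R.1 0) e) (R.1 0 e) ≤ δ := by
    intro e
    calc fd (gaugeTransform h (R.1 0) e) (R.1 0 e)
        ≤ fd (gaugeTransform h (R.1 0) e) (gaugeTransform h (P.1 0) e) + fd (gaugeTransform h (P.1 0) e) (R.1 0 e) :=
          fd_triangle _ _ _
      _ ≤ 3 / 2 * m + Real.sqrt (2 * D) := by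
          rw [fd_gaugeTransform_apply]; exact add_le_add (hRP1 0 e) (hlink_le 0 e)
  have hseamδ : ∀ x, fd (h x * R.2 x * (h x)⁻¹) (R.2 x) ≤ δ := by
    intro x
    calc fd (h x * R.2 x * (h x)⁻¹) (R.2 x)
        ≤ fd (h x * R.2 x * (h x)⁻¹) (h x * P.2 x * (h x)⁻¹) + fd (h x * P.2 x * (h x)⁻¹) (R.2 x) := fd_triangle _ _ _
      _ ≤ 3 / 2 * m + Real.sqrt (2 * D) := by
          rw [fd_mul_right, fd_mul_left]
          exact add_le_add (hRP2 x) (by simpa only [Pi.mul_apply, Pi.inv_apply] using hseam_le x)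
  obtain ⟨b, hb⟩ := exists_centreElem_fd_le_of_ringDeficit_eq_zero hL hz hR0 h hδ0 hlinkδ hseamδ
  set H : Site 3 L → SU2 := fun x => centreElem b * h x with hH
  have hhH : h = fun x => centreElem b * H x := by
    funext x; simp only [hH, ← mul_assoc, centreElem_mul_self, one_mul]
  set ε : ℝ := 9 * L * δ with hε
  have hε0 : 0 ≤ ε := by positivity
  have hεx : ∀ x, ‖(H x : Matrix (Fin 2) (Fin 2) ℂ) - 1‖ ≤ ε := fun x => by
    simp only [hH]; rw [norm_coe_centreElem_mul_sub_one]; exact hb x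
  -- the field `ξ`
  set ξ : Site 3 L → Matrix (Fin 2) (Fin 2) ℂ := fun x => (2 : ℝ)⁻¹ • ((H x : Matrix (Fin 2) (Fin 2) ℂ) - (H x : Matrix (Fin 2) (Fin 2) ℂ)ᴴ)
    with hξ
  refine ⟨ξ, fun x => conjTranspose_skewPart _, fun x => trace_skewPart_su2 (H x), ?_⟩
  -- the uniform per-variable remainder
  set ρ : ℝ := 2 * m ^ 2 + 3 / 2 * m * (ε + ε) + (1 + 3 / 2 * m) * (ε * ε) + (2 : ℝ)⁻¹ * ε ^ 2 + (2 : ℝ)⁻¹ * ε ^ 2 with hρ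
  have hρ0 : 0 ≤ ρ := by positivity
  -- per-link
  have hlink : ∀ i e, ‖A i e + (ξ e.1 - (R.1 0 e : Matrix (Fin 2) (Fin 2) ℂ) * ξ (e.1.shift e.2) * (R.1 0 e : Matrix (Fin 2) (Fin 2) ℂ)ᴴ)‖ ≤
      fd (gaugeTransform h (P.1 i) e) (R.1 i e) + ρ := by
    intro i e
    have hW : fd (gaugeTransform h (P.1 i) e) (R.1 i e) =
        ‖(H e.1 : Matrix (Fin 2) (Fin 2) ℂ) * exp (A i e) * (R.1 0 e : Matrix (Fin 2) (Fin 2) ℂ) *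
            (H (e.1.shift e.2) : Matrix (Fin 2) (Fin 2) ℂ)ᴴ * (R.1 0 e : Matrix (Fin 2) (Fin 2) ℂ)ᴴ - 1‖ := by
      rw [hhH, gaugeTransform_centreElem_mul, hRc i, fd_eq_norm_mul_conjTranspose_sub_one]
      have e1 : ((gaugeTransform H (P.1 i) e : SU2) : Matrix (Fin 2) (Fin 2) ℂ) =
          (H e.1 : Matrix (Fin 2) (Fin 2) ℂ) * (P.1 i e : Matrix (Fin 2) (Fin 2) ℂ) * (H (e.1.shift e.2) : Matrix (Fin 2) (Fin 2) ℂ)ᴴ := by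
        show (((H e.1 * P.1 i e * (H (e.1.shift e.2))⁻¹ : SU2)) : Matrix (Fin 2) (Fin 2) ℂ) = _
        rw [Submonoid.coe_mul, Submonoid.coe_mul]; rfl
      rw [e1, hP1 i e]
      simp only [Matrix.mul_assoc]
    have hmain := norm_linearised_link_le (su2_mem_unitaryGroup (H e.1)) (su2_mem_unitaryGroup (H (e.1.shift e.2)))
      (su2_mem_unitaryGroup (R.1 0 e)) hm (hA i e)
    rw [← hW] at hmain
    rw [← add_sub_assoc]
    refine hmain.trans (add_le_add le_rfl ?_)
    rw [hρ]
    exact linkRemainder_mono hm0 (norm_nonneg _) (norm_nonneg _) (hεx _) (hεx _)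
  -- per-site (seam)
  have hseam : ∀ x, ‖B x + (ξ x - (R.2 x : Matrix (Fin 2) (Fin 2) ℂ) * ξ x * (R.2 x : Matrix (Fin 2) (Fin 2) ℂ)ᴴ)‖ ≤
      fd ((h * P.2 * h⁻¹) x) (R.2 x) + ρ := by
    intro x
    have hW : fd ((h * P.2 * h⁻¹) x) (R.2 x) =
        ‖(H x : Matrix (Fin 2) (Fin 2) ℂ) * exp (B x) * (R.2 x : Matrix (Fin 2) (Fin 2) ℂ) *
            (H x : Matrix (Fin 2) (Fin 2) ℂ)ᴴ * (R.2 x : Matrix (Fin 2) (Fin 2) ℂ)ᴴ - 1‖ := by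
      simp only [Pi.mul_apply, Pi.inv_apply]
      rw [hhH]; dsimp only
      rw [centreElem_mul_conj, fd_eq_norm_mul_conjTranspose_sub_one, Submonoid.coe_mul, Submonoid.coe_mul,
        show (((H x)⁻¹ : SU2) : Matrix (Fin 2) (Fin 2) ℂ) = (H x : Matrix (Fin 2) (Fin 2) ℂ)ᴴ from rfl, hP2 x]
      simp only [Matrix.mul_assoc]
    have hmain := norm_linearised_link_le (su2_mem_unitaryGroup (H x)) (su2_mem_unitaryGroup (H x))
      (su2_mem_unitaryGroup (R.2 x)) hm (hB x)
    rw [← hW] at hmain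
    rw [← add_sub_assoc]
    refine hmain.trans (add_le_add le_rfl ?_)
    rw [hρ]
    exact linkRemainder_mono hm0 (norm_nonneg _) (norm_nonneg _) (hεx _) (hεx _)
  -- `ℓ²` assembly over the index set `(slices × links) ⊕ sites`
  set u : (Fin (2 * L - 1 + 1) × Edge 3 L) ⊕ Site 3 L → ℝ := Sum.elim
    (fun ie => ‖A ie.1 ie.2 + (ξ ie.2.1 - (R.1 0 ie.2 : Matrix (Fin 2) (Fin 2) ℂ) * ξ (ie.2.1.shift ie.2.2) * (R.1 0 ie.2 : Matrix (Fin 2) (Fin 2) ℂ)ᴴ)‖)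
    (fun x => ‖B x + (ξ x - (R.2 x : Matrix (Fin 2) (Fin 2) ℂ) * ξ x * (R.2 x : Matrix (Fin 2) (Fin 2) ℂ)ᴴ)‖) with hu
  set f : (Fin (2 * L - 1 + 1) × Edge 3 L) ⊕ Site 3 L → ℝ := Sum.elim
    (fun ie => fd (gaugeTransform h (P.1 ie.1) ie.2) (R.1 ie.1 ie.2)) (fun x => fd ((h * P.2 * h⁻¹) x) (R.2 x)) with hf
  have hU : (∑ i : Fin (2 * L - 1 + 1), ∑ e : Edge 3 L,
        ‖A i e + (ξ e.1 - (R.1 0 e : Matrix (Fin 2) (Fin 2) ℂ) * ξ (e.1.shift e.2) * (R.1 0 e : Matrix (Fin 2) (Fin 2) ℂ)ᴴ)‖ ^ 2) +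
      ∑ x : Site 3 L, ‖B x + (ξ x - (R.2 x : Matrix (Fin 2) (Fin 2) ℂ) * ξ x * (R.2 x : Matrix (Fin 2) (Fin 2) ℂ)ᴴ)‖ ^ 2 =
      ∑ v, u v ^ 2 := by
    rw [Fintype.sum_sum_type, Fintype.sum_prod_type]
    simp only [hu, Sum.elim_inl, Sum.elim_inr]
  have h2D : ∑ v, f v ^ 2 = 2 * D := by
    rw [Fintype.sum_sum_type, Fintype.sum_prod_type, hD_eq]
    simp only [hf, hf1, hf2, Sum.elim_inl, Sum.elim_inr]
  have hule : ∀ v, u v ≤ f v + ρ := by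
    rintro (⟨i, e⟩ | x)
    · simp only [hu, hf, Sum.elim_inl]; exact hlink i e
    · simp only [hu, hf, Sum.elim_inr]; exact hseam x
  have hu0 : ∀ v, 0 ≤ u v := by
    rintro (⟨i, e⟩ | x) <;> simp only [hu, Sum.elim_inl, Sum.elim_inr] <;> exact norm_nonneg _
  have hstep := sqrt_sum_sq_le_of_le_add_const hρ0 hu0 hule
  rw [h2D] at hstep
  rw [hU]
  refine hstep.trans (add_le_add le_rfl ?_)
  -- the index count: `#((slices × links) ⊕ sites) = 6L⁴ + L³ ≤ 7.29 L⁴`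
  have hcard : (Fintype.card ((Fin (2 * L - 1 + 1) × Edge 3 L) ⊕ Site 3 L) : ℝ) = 6 * (L : ℝ) ^ 4 + (L : ℝ) ^ 3 := by
    have hL' : 2 * L - 1 + 1 = 2 * L := by have := NeZero.one_le (n := L); omega
    rw [Fintype.card_sum, Fintype.card_prod, Fintype.card_fin, hL']
    simp only [Edge, Site, Fintype.card_prod, Fintype.card_pi, Finset.prod_const, Finset.card_univ, Fintype.card_fin, ZMod.card]
    push_cast; ring
  have hsqcard : Real.sqrt (Fintype.card ((Fin (2 * L - 1 + 1) × Edge 3 L) ⊕ Site 3 L) : ℝ) ≤ 27 / 10 * (L : ℝ) ^ 2 := by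
    rw [hcard]
    apply Real.sqrt_le_iff.mpr
    constructor
    · positivity
    · exact card_bound_aux hL1
  -- the remainder arithmetic
  calc Real.sqrt (Fintype.card ((Fin (2 * L - 1 + 1) × Edge 3 L) ⊕ Site 3 L) : ℝ) * ρ
      ≤ 27 / 10 * (L : ℝ) ^ 2 * ρ := mul_le_mul_of_nonneg_right hsqcard hρ0
    _ ≤ 2500 * (L : ℝ) ^ 4 * (m ^ 2 + D) := by
        rw [hρ]
        exact remainder_bound_aux hL1 hm0 hm hs0 hs2 hD0 (by rw [hε, hδ])


end Summit.QuantumFields.YangMills.Theorems.VirialFluxGap.ChartPhase
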